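import Literature.NumberTheory.EllipticCurves.RootNumberTableThreeKodairaProofs
import Literature.NumberTheory.EllipticCurves.RootNumberTableThreeCondExpProofs
import Literature.NumberTheory.DiophantineGeometry.TateAlgorithmAdditiveProofs
import Literature.NumberTheory.DiophantineGeometry.TateAlgorithmProofs
import Literature.NumberTheory.DiophantineGeometry.ConductorAdditiveProofs
import Literature.NumberTheory.DiophantineGeometry.Conductor
import HarnessLib

/-!
# Reduction type at `3` and the constant-sign rows, read from Rizzo's Table II

`Proofs` file (theorems only; no definition, no named fact) in topic
`NumberTheory/EllipticCurves`, sequel of `RootNumberTableThreeKodairaProofs`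
(`kodairaSymbolAt_eq_tableKodairaSymbolThree`: the Kodaira symbol of Tate's algorithm at the place
`v ∣ 3` of an elliptic `W/ℚ` is the Kod column of O. G. Rizzo, Compositio Math. 136 (2003), Table
II read on `c₄, c₆, Δ`; cell `b2b-bsdres`, team n1011, ROW T-PAP3-KOD).  Consequences:

* the REDUCTION TYPE of `E` at `3` (at a place above `3` of any integer ring `R` of `ℚ`, and at
  the place of `ℤ` of residue characteristic `3`) — good / multiplicative / additive
  (`DiophantineGeometry.LocalReduction`) — is the decidable predicate `IsGood` / `IsMultiplicative` /
  `IsAdditive` of the table's symbol `W.tableKodairaSymbolThree` (the discharged facts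
  `isGood_kodairaSymbolAt_iff`, `isAdditive_kodairaSymbolAt_iff` of `TateAlgorithm`, the residue
  field `𝔽₃` being perfect, and the two trichotomies);
* `v₃(Δ_min)` FROM THE TABLE: with the `v(N)` column (the discharged named fact
  `WeierstrassCurve.conductorExponent_eq_tableConductorExponentThree`, `RootNumberTableThreeCondExpProofs`)
  and Ogg's formula `f = v(Δ_min) + 1 − m` (`DiophantineGeometry.Conductor`, with Ogg–Saito
  `numComponentsAt_le`), `W.ordMinimalDiscriminant v = v(N) + m − 1` read on Table II — the valuation
  of the minimal discriminant at `3` of ANY equation (`ordMinimalDiscriminant_eq_table_three`);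
* the ROWS OF CONSTANT SIGN: on the rows of Table II of Kodaira type III, III* the `W₃` entry is
  `+1`, on those of type I₀* it is `−1` (pure evaluation of the transcription `Rizzo.tableII`), hence
  `W.kodairaSymbolAt v = III / III* ⇒ W.rootNumberThree = 1` and `= I₀* ⇒ W.rootNumberThree = −1` —
  the values of S. Kobayashi, Math. Ann. 323 (2002) 609–623, Thm. 1.1 (i)–(ii) (I₀, I₀*:
  `w = (−1|k)^{v(Δ)/2}`; III, III*: `w = (−2|k)`; held copy `paper:doi-10-1007-s002080200318`, p. 2)
  at `K = ℚ₃` (`(−2|𝔽₃) = +1`, `(−1|𝔽₃)³ = −1`) as read IN THE TABLE (a statement about the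
  table value `W.rootNumberThree`; its identification with `w(E/ℚ₃)` is the named fact
  `WeierstrassCurve.rootNumber_eq_neg_finprod_fullTableLocalRootNumberAt`, untouched) — the
  "symbol-wise corollary" asked for in `Summits/BirchSwinnertonDyer/Rank1Residual/O5/O5GlobalLine`.

## References

* O. G. Rizzo, Compositio Math. 136 (2003) 1–23, Table II (p. 4), columns Kod and W₃. [Rizzo2003]
* J. H. Silverman, *Advanced Topics in the Arithmetic of Elliptic Curves*, GTM 151 (1994), IV.9.4,
  Table 4.1. [Silverman1994]
-/

noncomputable section

open IsDedekindDomain IsLocalRing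
open Literature.NumberTheory.DiophantineGeometry
open Literature.NumberTheory.EllipticCurves Literature.NumberTheory.EllipticCurves.Rizzo

/-! ### The rows of constant sign (evaluation of the transcription) -/

namespace Literature.NumberTheory.EllipticCurves.Rizzo

open Literature.NumberTheory.DiophantineGeometry (KodairaSymbol)

/-- One step down the `if`-cascade of `Rizzo.tableII`, for an implication between the Kod and the
`W₃` columns holding on both branches. [folklore] -/
private theorem colImp_ite {c : Prop} [Decidable c] {K : KodairaSymbol} {s : ℤ}
    {v w : KodairaSymbol × ℕ × ℤ} (hv : v.1 = K → v.2.2 = s) (hw : w.1 = K → w.2.2 = s) :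
    (if c then v else w).1 = K → (if c then v else w).2.2 = s := by
  split <;> assumption

/-- On every row of Table II of Kodaira type III (rows `(≥2,3,3)` with the special condition,
`(2,≥5,3)`) the `W₃` entry is `+1`. [cite: Rizzo2003, Table II (p. 4), columns Kod and W₃] -/
theorem tableII_w_eq_one_of_kodaira_eq_III (a b : WithTop ℤ) (c x y z : ℤ)
    (h : (tableII a b c x y z).1 = .III) : (tableII a b c x y z).2.2 = 1 := by
  revert h
  unfold tableII; dsimp only
  repeat refine colImp_ite (by intro h; first | rfl | simp at h) ?_
  intro h; simp at h

/-- On every row of Table II of Kodaira type III* (rows `(≥4,6,9)` with the special condition,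
`(4,≥8,9)`) the `W₃` entry is `+1`. [cite: Rizzo2003, Table II (p. 4), columns Kod and W₃] -/
theorem tableII_w_eq_one_of_kodaira_eq_IIIstar (a b : WithTop ℤ) (c x y z : ℤ)
    (h : (tableII a b c x y z).1 = .IIIstar) : (tableII a b c x y z).2.2 = 1 := by
  revert h
  unfold tableII; dsimp only
  repeat refine colImp_ite (by intro h; first | rfl | simp at h) ?_
  intro h; simp at h

/-- On every row of Table II of Kodaira type I₀* (rows `(2,3,6)`, `(3,≥6,6)`) the `W₃` entry is
`−1`. [cite: Rizzo2003, Table II (p. 4), columns Kod and W₃] -/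
theorem tableII_w_eq_neg_one_of_kodaira_eq_Istar_zero (a b : WithTop ℤ) (c x y z : ℤ)
    (h : (tableII a b c x y z).1 = .Istar 0) : (tableII a b c x y z).2.2 = -1 := by
  revert h
  unfold tableII; dsimp only
  repeat refine colImp_ite (by intro h; first | rfl | simp at h) ?_
  intro h; simp at h

end Literature.NumberTheory.EllipticCurves.Rizzo

namespace WeierstrassCurve

/-! ### Reduction type at a place above `3` of any integer ring of `ℚ` -/

section AnyIntegerRing

open Rat.HeightOneSpectrum

variable {R : Type*} [CommRing R] [IsDedekindDomain R] [Algebra R ℚ] [IsFractionRing R ℚ]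
  [IsIntegralClosure R ℤ ℚ] (W : WeierstrassCurve ℚ) [W.IsElliptic] {v : HeightOneSpectrum R}

/-- **Good reduction at `3` from Table II** (place `v` above `3` of any integer ring `R` of `ℚ`):
`E/ℚ` has good reduction at `v` iff the Kod entry of Table II on `c₄, c₆, Δ` is `I₀` (rows
`(0,0,0)`, `(1,≥3,0)`; Tate's algorithm returns `I₀` exactly on good reduction,
`isGood_kodairaSymbolAt_iff`, the residue field `𝔽₃` being perfect).
[cite: Rizzo2003, Table II (p. 4), column Kod] [cite: Silverman1994, IV.9.4 and Table 4.1] -/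
theorem hasGoodReductionAt_iff_isGood_tableKodairaSymbolThree_of_primesEquiv_eq
    (hv : ((primesEquiv v : Nat.Primes) : ℕ) = 3) :
    W.HasGoodReductionAt v ↔ W.tableKodairaSymbolThree.IsGood := by
  rw [← kodairaSymbolAt_eq_tableKodairaSymbolThree_of_primesEquiv_eq v W hv]
  exact (W.isGood_kodairaSymbolAt_iff_holds v).symm

/-- **Additive reduction at `3` from Table II** (place `v` above `3` of any integer ring `R` of
`ℚ`): `E/ℚ` has additive reduction at `v` iff the Kod entry of Table II on `c₄, c₆, Δ` is of
additive type (`II, III, IV, Iₙ*, IV*, III*, II*`; `isAdditive_kodairaSymbolAt_iff`, the residue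
field `𝔽₃` being perfect) — a decidable test on the invariants of any equation.
[cite: Rizzo2003, Table II (p. 4), column Kod] [cite: Silverman1994, IV.9.4 and Table 4.1] -/
theorem hasAdditiveReductionAt_iff_isAdditive_tableKodairaSymbolThree_of_primesEquiv_eq
    (hv : ((primesEquiv v : Nat.Primes) : ℕ) = 3) :
    W.HasAdditiveReductionAt v ↔ W.tableKodairaSymbolThree.IsAdditive := by
  rw [← kodairaSymbolAt_eq_tableKodairaSymbolThree_of_primesEquiv_eq v W hv]
  exact (W.isAdditive_kodairaSymbolAt_iff_holds v).symm

/-- **Multiplicative reduction at `3` from Table II** (place `v` above `3` of any integer ring `R`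
of `ℚ`): `E/ℚ` has multiplicative reduction at `v` iff the Kod entry of Table II on `c₄, c₆, Δ` is
some `Iₙ`, `n ≥ 1` (row `(0,0,≥1)`, `n = v₃(Δ)` of the reduced triple) — by the two trichotomies
(reduction types at `v`, `DiophantineGeometry.LocalReduction`; Kodaira symbols) and the good /
additive readings. [cite: Rizzo2003, Table II (p. 4), column Kod]
[cite: Silverman1994, IV.9.4 and Table 4.1] -/
theorem hasMultiplicativeReductionAt_iff_isMultiplicative_tableKodairaSymbolThree_of_primesEquiv_eq
    (hv : ((primesEquiv v : Nat.Primes) : ℕ) = 3) :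
    W.HasMultiplicativeReductionAt v ↔ W.tableKodairaSymbolThree.IsMultiplicative := by
  have hg := hasGoodReductionAt_iff_isGood_tableKodairaSymbolThree_of_primesEquiv_eq W hv
  have ha := hasAdditiveReductionAt_iff_isAdditive_tableKodairaSymbolThree_of_primesEquiv_eq W hv
  constructor
  · intro h
    rcases KodairaSymbol.isGood_or_isMultiplicative_or_isAdditive W.tableKodairaSymbolThree with
        hG | hM | hA
    · exact absurd (hg.mpr hG) h.not_hasGoodReductionAt
    · exact hM
    · exact absurd (ha.mpr hA) h.not_hasAdditiveReductionAt
  · rintro ⟨n, hn, hk⟩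
    rcases hasGoodReductionAt_or_hasMultiplicativeReductionAt_or_hasAdditiveReductionAt v W with
        hG | hm | hA
    · have h0 : W.tableKodairaSymbolThree = .I 0 := hg.mp hG
      rw [h0] at hk
      exact absurd (KodairaSymbol.I.inj hk).symm hn
    · exact hm
    · exact absurd ⟨n, hn, hk⟩ (ha.mp hA).2

/-- **Type III at `3` ⇒ `W₃ = +1` in Table II** (place `v` above `3` of any integer ring of `ℚ`):
if Tate's algorithm at `v` returns `III`, the Table II local root number `W.rootNumberThree` is `+1`
(Kobayashi's `(−2|𝔽₃) = 1`, as transcribed). [cite: Rizzo2003, Table II (p. 4), columns Kod and W₃] -/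
theorem rootNumberThree_eq_one_of_kodairaSymbolAt_eq_III_of_primesEquiv_eq
    (hv : ((primesEquiv v : Nat.Primes) : ℕ) = 3) (h : W.kodairaSymbolAt v = .III) :
    W.rootNumberThree = 1 := by
  rw [kodairaSymbolAt_eq_tableKodairaSymbolThree_of_primesEquiv_eq v W hv] at h
  exact tableII_w_eq_one_of_kodaira_eq_III _ _ _ _ _ _ h

/-- **Type III* at `3` ⇒ `W₃ = +1` in Table II** (place `v` above `3` of any integer ring of `ℚ`).
[cite: Rizzo2003, Table II (p. 4), columns Kod and W₃] -/
theorem rootNumberThree_eq_one_of_kodairaSymbolAt_eq_IIIstar_of_primesEquiv_eq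
    (hv : ((primesEquiv v : Nat.Primes) : ℕ) = 3) (h : W.kodairaSymbolAt v = .IIIstar) :
    W.rootNumberThree = 1 := by
  rw [kodairaSymbolAt_eq_tableKodairaSymbolThree_of_primesEquiv_eq v W hv] at h
  exact tableII_w_eq_one_of_kodaira_eq_IIIstar _ _ _ _ _ _ h

/-- **Type I₀* at `3` ⇒ `W₃ = −1` in Table II** (place `v` above `3` of any integer ring of `ℚ`;
Kobayashi's `(−1|𝔽₃)^{v(Δ)/2}` with `v(Δ) = 6`, as transcribed).
[cite: Rizzo2003, Table II (p. 4), columns Kod and W₃] -/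
theorem rootNumberThree_eq_neg_one_of_kodairaSymbolAt_eq_Istar_zero_of_primesEquiv_eq
    (hv : ((primesEquiv v : Nat.Primes) : ℕ) = 3) (h : W.kodairaSymbolAt v = .Istar 0) :
    W.rootNumberThree = -1 := by
  rw [kodairaSymbolAt_eq_tableKodairaSymbolThree_of_primesEquiv_eq v W hv] at h
  exact tableII_w_eq_neg_one_of_kodaira_eq_Istar_zero _ _ _ _ _ _ h

end AnyIntegerRing

/-! ### The same at the place of `ℤ` of residue characteristic `3` (the shape of the named facts of
`RootNumberTableThree`) -/

section OverInt

variable (W : WeierstrassCurve ℚ) [W.IsElliptic] {v : HeightOneSpectrum ℤ}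

/-- **Good reduction at `3` from Table II**: `E/ℚ` has good reduction at the place `v ∣ 3` of `ℤ`
iff the Kod entry of Table II on `c₄, c₆, Δ` is `I₀`.
[cite: Rizzo2003, Table II (p. 4), column Kod] [cite: Silverman1994, IV.9.4 and Table 4.1] -/
theorem hasGoodReductionAt_iff_isGood_tableKodairaSymbolThree (hv : ringChar (ℤ ⧸ v.asIdeal) = 3) :
    W.HasGoodReductionAt v ↔ W.tableKodairaSymbolThree.IsGood := by
  rw [← kodairaSymbolAt_eq_tableKodairaSymbolThree W hv]
  exact (W.isGood_kodairaSymbolAt_iff_holds v).symm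

/-- **Additive reduction at `3` from Table II**: `E/ℚ` has additive reduction at the place `v ∣ 3`
of `ℤ` iff the Kod entry of Table II on `c₄, c₆, Δ` is of additive type — a decidable test on the
invariants of any equation. [cite: Rizzo2003, Table II (p. 4), column Kod]
[cite: Silverman1994, IV.9.4 and Table 4.1] -/
theorem hasAdditiveReductionAt_iff_isAdditive_tableKodairaSymbolThree
    (hv : ringChar (ℤ ⧸ v.asIdeal) = 3) :
    W.HasAdditiveReductionAt v ↔ W.tableKodairaSymbolThree.IsAdditive := by
  rw [← kodairaSymbolAt_eq_tableKodairaSymbolThree W hv]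
  exact (W.isAdditive_kodairaSymbolAt_iff_holds v).symm

/-- **Multiplicative reduction at `3` from Table II**: `E/ℚ` has multiplicative reduction at the
place `v ∣ 3` of `ℤ` iff the Kod entry of Table II on `c₄, c₆, Δ` is some `Iₙ`, `n ≥ 1`.
[cite: Rizzo2003, Table II (p. 4), column Kod] [cite: Silverman1994, IV.9.4 and Table 4.1] -/
theorem hasMultiplicativeReductionAt_iff_isMultiplicative_tableKodairaSymbolThree
    (hv : ringChar (ℤ ⧸ v.asIdeal) = 3) :
    W.HasMultiplicativeReductionAt v ↔ W.tableKodairaSymbolThree.IsMultiplicative := by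
  have hg := hasGoodReductionAt_iff_isGood_tableKodairaSymbolThree W hv
  have ha := hasAdditiveReductionAt_iff_isAdditive_tableKodairaSymbolThree W hv
  constructor
  · intro h
    rcases KodairaSymbol.isGood_or_isMultiplicative_or_isAdditive W.tableKodairaSymbolThree with
        hG | hM | hA
    · exact absurd (hg.mpr hG) h.not_hasGoodReductionAt
    · exact hM
    · exact absurd (ha.mpr hA) h.not_hasAdditiveReductionAt
  · rintro ⟨n, hn, hk⟩
    rcases hasGoodReductionAt_or_hasMultiplicativeReductionAt_or_hasAdditiveReductionAt v W with
        hG | hm | hA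
    · have h0 : W.tableKodairaSymbolThree = .I 0 := hg.mp hG
      rw [h0] at hk
      exact absurd (KodairaSymbol.I.inj hk).symm hn
    · exact hm
    · exact absurd ⟨n, hn, hk⟩ (ha.mp hA).2

/-- **`v₃(Δ_min)` from Table II.**  For an elliptic `W/ℚ` (any equation) and the place `v ∣ 3` of
`ℤ`, the valuation of the minimal discriminant is read on Table II: `v₃(Δ_min) = v(N) + m − 1`, with
`v(N) = W.tableConductorExponentThree` (the discharged named fact
`conductorExponent_eq_tableConductorExponentThree`) and `m` the number of components of the Kod
entry (`numComponentsAt_eq_numComponents_tableKodairaSymbolThree`), by Ogg's formula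
`f_v = v(Δ_min) + 1 − m_v` (the tree's definition of `conductorExponent`) and Ogg–Saito
`m_v ≤ v(Δ_min) + 1` (`numComponentsAt_le`). [cite: Rizzo2003, Table II (p. 4), columns Kod and v(N)]
[cite: Silverman1994, IV.11.1 and Table 4.1] -/
theorem ordMinimalDiscriminant_eq_table_three (hv : ringChar (ℤ ⧸ v.asIdeal) = 3) :
    W.ordMinimalDiscriminant v =
      W.tableConductorExponentThree + W.tableKodairaSymbolThree.numComponents - 1 := by
  have hf : W.conductorExponent v = W.tableConductorExponentThree :=
    conductorExponent_eq_tableConductorExponentThree_holds W v hv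
  have hm := numComponentsAt_eq_numComponents_tableKodairaSymbolThree W hv
  have hle : W.numComponentsAt v ≤ W.ordMinimalDiscriminant v + 1 := W.numComponentsAt_le_holds v
  have hpos : 0 < W.tableKodairaSymbolThree.numComponents := KodairaSymbol.numComponents_pos _
  unfold conductorExponent at hf
  omega

/-- **Type III at `3` ⇒ `W₃ = +1` in Table II** (place of `ℤ` above `3`).
[cite: Rizzo2003, Table II (p. 4), columns Kod and W₃] -/
theorem rootNumberThree_eq_one_of_kodairaSymbolAt_eq_III (hv : ringChar (ℤ ⧸ v.asIdeal) = 3)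
    (h : W.kodairaSymbolAt v = .III) : W.rootNumberThree = 1 := by
  rw [kodairaSymbolAt_eq_tableKodairaSymbolThree W hv] at h
  exact tableII_w_eq_one_of_kodaira_eq_III _ _ _ _ _ _ h

/-- **Type III* at `3` ⇒ `W₃ = +1` in Table II** (place of `ℤ` above `3`).
[cite: Rizzo2003, Table II (p. 4), columns Kod and W₃] -/
theorem rootNumberThree_eq_one_of_kodairaSymbolAt_eq_IIIstar (hv : ringChar (ℤ ⧸ v.asIdeal) = 3)
    (h : W.kodairaSymbolAt v = .IIIstar) : W.rootNumberThree = 1 := by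
  rw [kodairaSymbolAt_eq_tableKodairaSymbolThree W hv] at h
  exact tableII_w_eq_one_of_kodaira_eq_IIIstar _ _ _ _ _ _ h

/-- **Type I₀* at `3` ⇒ `W₃ = −1` in Table II** (place of `ℤ` above `3`).
[cite: Rizzo2003, Table II (p. 4), columns Kod and W₃] -/
theorem rootNumberThree_eq_neg_one_of_kodairaSymbolAt_eq_Istar_zero
    (hv : ringChar (ℤ ⧸ v.asIdeal) = 3) (h : W.kodairaSymbolAt v = .Istar 0) :
    W.rootNumberThree = -1 := by
  rw [kodairaSymbolAt_eq_tableKodairaSymbolThree W hv] at h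
  exact tableII_w_eq_neg_one_of_kodaira_eq_Istar_zero _ _ _ _ _ _ h

end OverInt

end WeierstrassCurve

end
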